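import Literature.AlgebraicGeometry.AbelianSchemes.SerreTensorIdealTranslationQuasiInverse   -- ★ `serreTranslateInv` (`ψ′`), `serrePresentationHom`, `serreTensorOneIso`
import Literature.AlgebraicGeometry.AbelianSchemes.AbelianSchemeTwistedFibreTransport        -- ★ p846337 (F1) pin + ★ `SerreTensorIdealTranslationBaseChange` (`serreTensorBaseChangeIso'_hom_serreι`)
import HarnessLib

/-!
# Base change of the Serre cover `ψ′ : A ⊗_𝒪 𝔟 → A`: `(ψ′)_{S′} = β ≫ ψ′(A_{S′})` under `β : (A ⊗_𝒪 𝔟)_{S′} ≅ A_{S′} ⊗_𝒪 𝔟`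

Topic `AlgebraicGeometry/AbelianSchemes`; namespace `Literature.AlgebraicGeometry.AbelianSchemes.AbelianSchemeOver`.  THEOREMS ONLY (no
definition, no instance, no notation, no named fact, no `sorry`; ANY base change `g : S′ ⟶ S`).  Cell `hodgecm-mathlib` (D-0151), programme
P6 «MOD» (crux hLiu418 = stmt-HodgeConjecture-24832, `--supports`, count-neutral): the OPEN row (S) named by A-p06 (g30) at the close of organ
(O-γ) «SERRE TWIST OF A PEL FAMILY» (2026-09-01 18:55Z): the companion of ★ `serreTranslateBC_comp_baseChangeIso` (base change of the ideal
translation `ψ_P : A → A ⊗ 𝔟`) for its quasi-inverse, the COVER `ψ′ = serreTranslateInv act E′ hE′ Q : A ⊗ 𝔟 → A` — needed because the P6a desk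
types the TWIST law of `ModuliDatum` in COVER orientation (`c : A_{γx̄} → A_x̄` is the `ψ′`-direction; F0P6a-plan (g1) 18:37Z).  HC_CM is
proved only modulo the printed citations until rung 0 closes; this file is generic and changes no count.

THE PRINT ([Conrad2004GrossZagier] §7, Thm. 7.5: Serre's construction and its structure maps commute with base change; [Kottwitz1992] §5 p. 390).
With `A ⊗_𝒪 𝔟 = Fix([E′] ↷ Aᵐ) ↪ Aᵐ` (★ `serreι`) the cover is the composite **`ψ′ = ι ≫ [Q] ≫ pr₀`** (`[Q] : Aᵐ → A¹` the matrix
homomorphism of the row `Q`, ★ `matrixHom`; §2, definitional unfolding of ★ `serrePresentationHom` + ★ `serreTensorOneIso` with `π₁ ≫ ι₁ = [1] = 𝟙`),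
a formula with NO hypothesis on `Q`.  Base change is a functor commuting with the coordinate projections (★ `powBC`), and `[Q]_{S′} ≫ powBC =
powBC ≫ [Q]′` for RECTANGULAR `Q` (§1, the `m × n` version of ★ `endBC_matrixEnd_comp_powBC`); with ★ `β ≫ ι′ = ι_{S′} ≫ powBC` this gives
**`(ψ′)_{S′} = β ≫ ψ′(A_{S′})`** (§3), and on a fibre `s : Spec Ω → S` the homomorphism of abelian varieties `ψ′_s` IS `ψ′` of the fibre `A_s` under the
pinned identification `(A ⊗ 𝔟)_s ≅ A_s ⊗ 𝔟` of ★ p846337 (§4).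

* §1 `pullback_map_matrixHom_comp_powBC` — `[P]_{S′} ≫ powBC = powBC ≫ [P]′` for `P ∈ M_{m×n}(𝒪)`;
* §2 `serreTranslateInv_eq_serreι_comp` — `ψ′ = ι ≫ [Q] ≫ pr₀`;
* §3 **`pullback_map_serreTranslateInv_eq`** — `(ψ′)_{S′} = β.hom ≫ ψ′(A_{S′})`, and `baseChangeIso'_inv_comp_pullback_map_serreTranslateInv`
  (`β.inv ≫ (ψ′)_{S′} = ψ′(A_{S′})`);
* §4 `fibreHom_serreTranslateInv_eq` — the fibre reading through the (F1) pin of ★ `AbelianSchemeTwistedFibreTransport`.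

## References
* [Conrad2004GrossZagier] B. Conrad, *Gross–Zagier revisited*, MSRI Publ. 49 (2004) — §7 (Thm. 7.5).
* [Kottwitz1992] R. Kottwitz, *Points on some Shimura varieties over finite fields*, JAMS 5 (1992) — §5 (p. 390).
* [GortzWedhorn2020] U. Görtz, T. Wedhorn, *Algebraic Geometry I*, 2nd ed. (2020) — Section (4.7) (pp. 107–108).
-/

noncomputable section

universe u

open CategoryTheory Limits AlgebraicGeometry MonoidalCategory CartesianMonoidalCategory MonObj

namespace Literature.AlgebraicGeometry.AbelianSchemes.AbelianSchemeOver

open Literature.AlgebraicGeometry.Motives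

set_option backward.isDefEq.respectTransparency false

variable {S S' : Scheme.{u}} (g : S' ⟶ S) {A : AbelianSchemeOver S} {O : Type*} [CommRing O] (act : A.RingAction O)
  [IsCommMonObj A.X]

/-! ### §1 Rectangular matrix homomorphisms commute with `powBC` -/

/-- **`[P]_{S′} ≫ powBC = powBC ≫ [P]′`** for a RECTANGULAR matrix `P ∈ M_{m×n}(𝒪)`: under `(Aⁿ)_{S′} ≅ (A_{S′})ⁿ`, `(Aᵐ)_{S′} ≅ (A_{S′})ᵐ` the base
change of `[P] : Aⁿ → Aᵐ` is `[P]` of the base-changed action (the `m × n` version of ★ `endBC_matrixEnd_comp_powBC`; coordinates: `pr_j ∘ [P] =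
∏_k ι(P_{jk}) ∘ pr_k` and base change preserves products of points). [cite: Kottwitz1992, §5 (p. 390)] [cite: GortzWedhorn2020, Section (4.7) (pp. 107–108)] -/
theorem pullback_map_matrixHom_comp_powBC {m n : ℕ} (P : Matrix (Fin m) (Fin n) O) :
    ((Over.pullback g).map (matrixHom act P) : ((A.pow n).baseChange g).X ⟶ ((A.pow m).baseChange g).X) ≫ powBC g A m =
      powBC g A n ≫ @matrixHom S' (A.baseChange g) O _ (act.baseChange g) (isCommMonObj_baseChange g) m n P := by
  haveI := isCommMonObj_baseChange g (A := A)
  apply pow_hom_ext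
  intro j
  have hR := congrFun (powHomEquiv_comp_matrixHom (act.baseChange g) P (powBC g A n)) j
  rw [powHomEquiv_apply] at hR
  rw [Category.assoc, hR, powBC_powProj]
  have hL : ((Over.pullback g).map (matrixHom act P) : ((A.pow n).baseChange g).X ⟶ ((A.pow m).baseChange g).X) ≫ powProjBC g A m j =
      (Over.pullback g).map (matrixHom act P ≫ A.powProj m j) := ((Over.pullback g).map_comp _ _).symm
  rw [hL, ← powHomEquiv_apply (matrixHom act P), powHomEquiv_matrixHom]
  unfold matrixCompRect
  rw [pullback_map_finset_prod]
  refine Finset.prod_congr rfl fun k _ => ?_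
  rw [Functor.map_comp, powHomEquiv_apply, powBC_powProj]
  rfl

/-! ### §2 The cover as a composite: `ψ′ = ι ≫ [Q] ≫ pr₀` -/

/-- **`ψ′ = ι ≫ [Q] ≫ pr₀`** — the Serre cover `serreTranslateInv act E′ hE′ Q : A ⊗_𝒪 𝔟 → A` is the inclusion `A ⊗ 𝔟 ↪ Aᵐ` followed by the
matrix homomorphism of the row `Q` and the (only) projection `A¹ → A`; NO hypothesis on `Q` (unfolding ★ `serrePresentationHom` = `(ι ≫ [Q]) ≫ π₁`
and ★ `serreTensorOneIso.hom = ι₁ ≫ pr₀` with `π₁ ≫ ι₁ = [1] = 𝟙`). [cite: Conrad2004GrossZagier, §7 (Thm. 7.5)] [cite: Kottwitz1992, §5 (p. 390)] -/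
theorem serreTranslateInv_eq_serreι_comp {m : ℕ} (E' : Matrix (Fin m) (Fin m) O) (hE' : E' * E' = E')
    (Q : Matrix (Fin 1) (Fin m) O) :
    serreTranslateInv act E' hE' Q = serreι act E' hE' ≫ matrixHom act Q ≫ A.powProj 1 0 := by
  haveI := isMonHom_matrixEnd act E'
  haveI := isMonHom_matrixEnd act (1 : Matrix (Fin 1) (Fin 1) O)
  have h1 : serreπ act (1 : Matrix (Fin 1) (Fin 1) O) one_mul_one_fin_one ≫ serreι act 1 one_mul_one_fin_one = 𝟙 _ := by
    rw [(serreπ_ι_and_ι_π act (1 : Matrix (Fin 1) (Fin 1) O) one_mul_one_fin_one).1, matrixEnd_one]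
  change ((serreι act E' hE' ≫ matrixHom act Q) ≫ serreπ act (1 : Matrix (Fin 1) (Fin 1) O) one_mul_one_fin_one) ≫
      (serreι act 1 one_mul_one_fin_one ≫ A.powProj 1 0) = _
  rw [Category.assoc, Category.assoc, ← Category.assoc (serreπ act _ _), h1, Category.id_comp]

/-! ### §3 Base change of the cover -/

/-- **BASE CHANGE OF THE SERRE COVER: `(ψ′)_{S′} = β.hom ≫ ψ′(A_{S′})`** for `β = serreTensorBaseChangeIso′ g act E′ hE′ : (A ⊗_𝒪 𝔟)_{S′} ≅ A_{S′} ⊗_𝒪 𝔟`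
— the companion of ★ `serreTranslateBC_comp_baseChangeIso` (`(ψ_P)_{S′} ≫ β.hom = ψ_P(A_{S′})`) for the quasi-inverse direction; NO hypothesis on `Q`
(§2 on both sides, ★ `serreTensorBaseChangeIso′_hom_serreι`, §1, ★ `powBC_powProj`). [cite: Conrad2004GrossZagier, §7 (Thm. 7.5)]
[cite: GortzWedhorn2020, Section (4.7) (pp. 107–108)] -/
theorem pullback_map_serreTranslateInv_eq {m : ℕ} (E' : Matrix (Fin m) (Fin m) O) (hE' : E' * E' = E') (Q : Matrix (Fin 1) (Fin m) O) :
    ((Over.pullback g).map (serreTranslateInv act E' hE' Q) : ((serreTensor act E' hE').baseChange g).X ⟶ (A.baseChange g).X) =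
      (serreTensorBaseChangeIso' g act E' hE').hom ≫
        @serreTranslateInv S' (A.baseChange g) O _ (act.baseChange g) (isCommMonObj_baseChange g) m E' hE' Q := by
  haveI := isCommMonObj_baseChange g (A := A)
  rw [serreTranslateInv_eq_serreι_comp act E' hE' Q, serreTranslateInv_eq_serreι_comp (act.baseChange g) E' hE' Q, Functor.map_comp,
    Functor.map_comp, ← Category.assoc (serreTensorBaseChangeIso' g act E' hE').hom]
  change _ = (_ ≫ @serreι S' (A.baseChange g) O _ (act.baseChange g) (isCommMonObj_baseChange g) m E' hE') ≫ _
  rw [serreTensorBaseChangeIso'_hom_serreι, Category.assoc, ← Category.assoc (powBC g A m),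
    ← pullback_map_matrixHom_comp_powBC g act Q, Category.assoc, powBC_powProj]
  rfl

/-- The same with `β` on the other side: **`β.inv ≫ (ψ′)_{S′} = ψ′(A_{S′})`**. [cite: Conrad2004GrossZagier, §7 (Thm. 7.5)] -/
theorem baseChangeIso'_inv_comp_pullback_map_serreTranslateInv {m : ℕ} (E' : Matrix (Fin m) (Fin m) O) (hE' : E' * E' = E')
    (Q : Matrix (Fin 1) (Fin m) O) :
    (serreTensorBaseChangeIso' g act E' hE').inv ≫
        ((Over.pullback g).map (serreTranslateInv act E' hE' Q) : ((serreTensor act E' hE').baseChange g).X ⟶ (A.baseChange g).X) =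
      @serreTranslateInv S' (A.baseChange g) O _ (act.baseChange g) (isCommMonObj_baseChange g) m E' hE' Q := by
  rw [pullback_map_serreTranslateInv_eq, Iso.inv_hom_id_assoc]

/-! ### §4 The fibre reading -/

/-- **ON A FIBRE: `ψ′_s` IS `ψ′` OF `A_s`** — for a field-valued point `s` and the identification `e : ((A ⊗ 𝔟)_s) ≅ A_s ⊗ 𝔟` of abelian varieties
PINNED to `β` (★ `AbelianSchemeTwistedFibreTransport.exists_fibreIso_serreTensor_fibre`), the fibre homomorphism `ψ′_s` equals `e` followed by the
cover of the fibre: `(fibreHom ψ′ s) = e ≫ ψ′(A_s)` on underlying morphisms. [cite: Conrad2004GrossZagier, §7 (Thm. 7.5)] -/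
theorem fibreHom_serreTranslateInv_eq {Ω : Type u} [Field Ω] (s : Spec (.of Ω) ⟶ S) {m : ℕ} (E' : Matrix (Fin m) (Fin m) O)
    (hE' : E' * E' = E') (Q : Matrix (Fin 1) (Fin m) O)
    (e : ((serreTensor act E' hE').fibre s).toAbelianVariety ≅ (serreTensorBC s act E' hE').toAffine.toAbelianVariety)
    (he : e.hom.hom.hom.hom = (serreTensorBaseChangeIso' s act E' hE').hom) :
    haveI := isMonHom_serreTranslateInv act E' hE' Q
    (fibreHom (serreTranslateInv act E' hE' Q) s).hom.hom.hom =
      e.hom.hom.hom.hom ≫ @serreTranslateInv _ (A.baseChange s) O _ (act.baseChange s) (isCommMonObj_baseChange s) m E' hE' Q := by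
  haveI := isMonHom_serreTranslateInv act E' hE' Q
  rw [fibreHom_hom_hom_hom, he]
  exact pullback_map_serreTranslateInv_eq s act E' hE' Q

end Literature.AlgebraicGeometry.AbelianSchemes.AbelianSchemeOver

end
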